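import Summits.BirchSwinnertonDyer.BirchSwinnertonDyer.Theorems.SchneiderFreeAdditiveX3GordTwoBranchIMCOfKYBranchArtin
import Summits.BirchSwinnertonDyer.BirchSwinnertonDyer.Theorems.SchneiderFreeAdditiveX3KYReadValueOfCHFrame
import HarnessLib
import HarnessLib.Audit.Tags

/-!
# Route `SchneiderFreeAdditiveX3` (K1 door), crux `GordTwoBranchIMC` (stmt-BirchSwinnertonDyer-19177):
# the value half at every `μ = 0` frame ⇐ ONE printed frame value — frame prime and embedding prime
# DECOUPLED; and the (G-ord, `e = 2`) socket with `KYReadCHValue` discharged for EVERY complex embedding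

Cell `bsd-schneider-ideate`, seat `door-c3` gen 10. Sequel of `…KYReadValueOfCHFrame.lean` (p512179; `hind`
at `𝔭′`). For an arbitrary Heegner embedding `ι_c` the prime induced by `ι′⁻¹ ∘ ι_c` is
`primeOfEmbeddingDatum p ι′ ι_c ∈ {𝔭, 𝔭′}`; `hval_of_CH_frame_value_at` reads the logarithm at whichever
prime is induced, and `additiveIMCLowerBDPOnTreeLeAt_of_CH_frame_value_artin'` moves it back to `𝔭′` by
the rank-one symmetry (`hasValueAt_sq_logOmega_embAt_iff_of_rank_one`), so NO hypothesis on `ι_c`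
remains: inputs = gen 9's socket inputs − `hval` + {Castella–Hsieh's own frame at `𝔭′` with its
printed-shape value (cite item wi-73260), `thm351_mu_zero_branch_OPEN` (PREPRINT)}. Closes nothing.
-/

noncomputable section

open scoped Classical NNReal

open WeierstrassCurve NumberField IsDedekindDomain Field PowerSeries
  Literature.NumberTheory.EllipticCurves
  Literature.NumberTheory.EllipticCurves.ModularForms
  Literature.NumberTheory.EllipticCurves.FormalGroupChart
  Literature.NumberTheory.EllipticCurves.KellerYin2024
  Summit.BirchSwinnertonDyer.Rank1Residual
  Summit.BirchSwinnertonDyer.Rank1Residual.X11b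
  Summit.BirchSwinnertonDyer.Rank1Residual.X11b.Halves

set_option linter.dupNamespace false
set_option autoImplicit false

namespace Summit.BirchSwinnertonDyer.BirchSwinnertonDyer.Theorems.SchneiderFree.KYRead.LogDescent

variable {p : ℕ} [Fact p.Prime]

section MainAt

variable (W' : WeierstrassCurve ℚ) [W'.IsGloballyMinimal]
  [NeZero (W'.conductorNorm ℤ)] (hgood : W'.HasGoodReductionAtPrime p) (D C₂ : VariableChange ℚ) [(D • W').IsCharNeTwoNF]
  [(C₂ • (D • W').quadraticTwist ((-1 : ℚ) ^ (p / 2) * p)).IsElliptic]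
  [(C₂ • (D • W').quadraticTwist ((-1 : ℚ) ^ (p / 2) * p)).IsGloballyMinimal]
  {N : ℕ} {K : Type} [Field K] [NumberField K] [IsGalois ℚ K] (h2 : Module.finrank ℚ K = 2)
  (H : HeegnerDatum N (NumberField.discr K))
  {κ : ZpExtension K p} {γ : Field.absoluteGaloisGroup K}
  {v 𝔮₀ 𝔮 : HeightOneSpectrum (𝓞 K)} (h𝔮₀ : ((p : ℕ) : 𝓞 K) ∈ 𝔮₀.asIdeal)
  (he₀ : 𝔮₀.asIdeal.ramificationIdx (𝓞 ℚ) = 1) (hf₀ : 𝔮₀.asIdeal.inertiaDeg (𝓞 ℚ) = 1)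
  (h𝔮 : ((p : ℕ) : 𝓞 K) ∈ 𝔮.asIdeal)
  (he𝔮 : 𝔮.asIdeal.ramificationIdx (𝓞 ℚ) = 1) (hf𝔮 : 𝔮.asIdeal.inertiaDeg (𝓞 ℚ) = 1)
  (hne : 𝔮₀ ≠ 𝔮) (ι' : PadicAlgCl p ≃+* ℂ) (ιc : K →+* ℂ) [NumberField (ringClassField K ιc p)]
  (hind : ∀ k : 𝓞 K, k ∈ 𝔮.asIdeal ↔ ‖ι'.symm (ιc (k : K))‖ < 1)
  (Dt' : ModularParametrizationData W' (W'.conductorNorm ℤ))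
  (I : Ideal (UnrSeries p))
  (hspan : ∀ (e : ℂ) (ΩK : ℂ) (Ωp : (unrIntegers p)ˣ) (L : UnrSeries p), e ≠ 0 → ΩK ≠ 0 →
    IsBranchBDPLFunction ι' v κ γ Dt'.f (genusHeckeCharacter K p) e ΩK
      ((Ωp : unrIntegers p) : ℂ_[p]) L →
    ¬ C (p : unrIntegers p) ∣ L → I = Ideal.span {L})
  {e_c : ℂ} {ΩK_c : ℂ} {Ωp_c : (unrIntegers p)ˣ} {L_c : UnrSeries p} (he_c : e_c ≠ 0)
  (hΩK_c : ΩK_c ≠ 0)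
  (hL_c : IsBranchBDPLFunction ι' v κ γ Dt'.f (genusHeckeCharacter K p) e_c ΩK_c
    ((Ωp_c : unrIntegers p) : ℂ_[p]) L_c)
  (hμ_c : ¬ C (p : unrIntegers p) ∣ L_c) (u_c : unrIntegers p)
  (hval_c : ∀ (y : (W'.baseChange (ringClassField K ιc p : Type)).toAffine.Point),
    WeierstrassCurve.Affine.Point.map (ringClassField K ιc p).subtype.toRatAlgHom y =
      heegnerPointComplexOfConductor Dt' (NumberField.discr K) H.β p →
    ∀ (θ : ringClassField K ιc p)
      (_ : θ ^ 2 = algebraMap ℚ (ringClassField K ιc p) ((-1 : ℚ) ^ (p / 2) * p)) (_ : θ ≠ 0)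
      (s : ringClassGal ιc p → ℤˣ),
      (∀ σ : ringClassGal ιc p, σ.1 θ = ((s σ : ℤ) : ringClassField K ιc p) * θ) →
      L_c.HasValueAt 0 (((u_c : unrIntegers p) : ℂ_[p]) *
        (@padicLogPointFiniteExt ℂ_[p] _ NormedField.valuation (W'.baseChange ℂ_[p]) p
          (isIntegral_valuation_baseChange W' ℂ_[p])
          (WeierstrassCurve.Affine.Point.map
            ((algebraMap (PadicAlgCl p) ℂ_[p]).comp
              (ι'.symm.toRingHom.comp (ringClassField K ιc p).subtype)).toRatAlgHom
            (∑ τ : ringClassGal ιc p,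
              (s τ : ℤ) • pointGalHom W' (ringClassField K ιc p : Type) τ.1 y))) ^ 2))

include hgood h2 h𝔮₀ he₀ hf₀ hne hind hspan he_c hΩK_c hL_c hμ_c hval_c in
/-- **`hval_of_CH_frame_value` with the frame's prime `v` and the embedding's prime `𝔮` DECOUPLED**:
frames (`hspan`, `L_c`) at any `v`; `ι′⁻¹ ∘ ι_c` induces the degree-one `𝔮` (`hind`), `𝔮₀ ≠ 𝔮` another
degree-one prime; output logarithm at `embAt K p 𝔮`. Same proof as `hval_of_CH_frame_value`.
[cite: CastellaHsieh2018, Thm. 5.7 and Lemma 5.4 (arXiv:1505.08165 pp. 17–19) (shape of hval_c)]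
[cite: KellerYin2024b, Thm. 3.5.1 (arXiv:2410.23241 p. 20) (shape of hspan; preprint)] -/
theorem hval_of_CH_frame_value_at :
    ∀ (e : ℂ) (ΩK : ℂ) (Ωp : (unrIntegers p)ˣ) (L : UnrSeries p), e ≠ 0 → ΩK ≠ 0 →
      IsBranchBDPLFunction ι' v κ γ Dt'.f (genusHeckeCharacter K p) e ΩK
        ((Ωp : unrIntegers p) : ℂ_[p]) L →
      ¬ C (p : unrIntegers p) ∣ L →
      ∃ u : unrIntegers p,
      ∀ (y : (W'.baseChange (ringClassField K ιc p : Type)).toAffine.Point),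
      WeierstrassCurve.Affine.Point.map (ringClassField K ιc p).subtype.toRatAlgHom y =
        heegnerPointComplexOfConductor Dt' (NumberField.discr K) H.β p →
      ∀ (θ : ringClassField K ιc p)
      (hθ2 : θ ^ 2 = algebraMap ℚ (ringClassField K ιc p) ((-1 : ℚ) ^ (p / 2) * p)) (hθ : θ ≠ 0)
      (s : ringClassGal ιc p → ℤˣ),
      (∀ σ : ringClassGal ιc p, σ.1 θ = ((s σ : ℤ) : ringClassField K ιc p) * θ) →
      ∀ Q : ((C₂ • (D • W').quadraticTwist ((-1 : ℚ) ^ (p / 2) * p)).baseChange K).toAffine.Point,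
      Affine.Point.map (algebraMap K (ringClassField K ιc p)).toRatAlgHom Q =
        VariableChange.pointEquivBaseChange ((D • W').quadraticTwist ((-1 : ℚ) ^ (p / 2) * p)) C₂
          (ringClassField K ιc p)
          ((VariableChange.pointEquiv (((D • W').quadraticTwist ((-1 : ℚ) ^ (p / 2) * p)).baseChange
              (ringClassField K ιc p : Type)) (untwistAt hθ)).symm
            ((Affine.Point.congrEquiv (untwistAt_smul_eq (D • W') hθ2 hθ)).symm
              (VariableChange.pointEquivBaseChange W' D (ringClassField K ιc p)
                (∑ τ : ringClassGal ιc p,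
                  (s τ : ℤ) • pointGalHom W' (ringClassField K ιc p : Type) τ.1 y)))) →
      L.HasValueAt 0 (((u : unrIntegers p) : ℂ_[p]) *
        (algebraMap ℚ_[p] ℂ_[p] (logOmega (C₂ • (D • W').quadraticTwist ((-1 : ℚ) ^ (p / 2) * p))
          p (embAt K p 𝔮 h𝔮 he𝔮 hf𝔮) Q / (Dt'.c : ℚ_[p]))) ^ 2) := by
  intro e ΩK Ωp L he0 hΩK hL hμ
  -- (1) the two `μ = 0` frames generate the same ideal: value transfer up to a unit `U`
  have hLL : Ideal.span {L} = Ideal.span {L_c} :=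
    (hspan e ΩK Ωp L he0 hΩK hL hμ).symm.trans (hspan e_c ΩK_c Ωp_c L_c he_c hΩK_c hL_c hμ_c)
  obtain ⟨U, hU⟩ := exists_unit_forall_hasValueAt_zero_of_span_eq hLL
  -- (2) the rational factor `p* · c′² / (u_{C₂}u_D)²` is `p`-integral
  have hΔ' : ¬ (p : ℤ) ∣ minimalDiscriminantInt W' :=
    W'.not_dvd_minimalDiscriminantInt_of_hasGoodReductionAtPrime' p hgood
  have hp : (p : ℚ) ≠ 0 := Nat.cast_ne_zero.mpr (Fact.out : p.Prime).ne_zero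
  have hd0 : ((-1 : ℚ) ^ (p / 2) * p : ℚ) ≠ 0 := mul_ne_zero (pow_ne_zero _ (by norm_num)) hp
  obtain ⟨θ₀, hθ₀⟩ := IsAlgClosed.exists_pow_nat_eq (algebraMap ℚ ℂ_[p] ((-1 : ℚ) ^ (p / 2) * p))
    (by norm_num : 0 < 2)
  have hθ₀0 : θ₀ ≠ 0 := by
    intro h0
    rw [h0, zero_pow two_ne_zero, eq_comm, _root_.map_eq_zero] at hθ₀
    exact hd0 hθ₀
  have hee : ∀ x : ℚ_[p], ‖algebraMap ℚ_[p] ℂ_[p] x‖ = ‖x‖ := fun x ↦ PadicComplex.norm_extends' (p := p) x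
  have hCV := compositeChange_smul (L := ℂ_[p]) W' D C₂ ((-1 : ℚ) ^ (p / 2) * p) hθ₀ hθ₀0
  have hu1 := one_le_val_u_of_smul_eq p W' D C₂ ((-1 : ℚ) ^ (p / 2) * p) (algebraMap ℚ_[p] ℂ_[p])
    hee hCV hΔ'
  rw [compositeChange_u (L := ℂ_[p]) D C₂ hθ₀0, NormedField.valuation_apply, ← NNReal.coe_le_coe,
    NNReal.coe_one, coe_nnnorm, norm_mul, norm_inv] at hu1
  -- `‖θ₀‖² = ‖p*‖ = p⁻¹` and `‖θ₀‖ ≤ ‖u_{C₂} u_D‖`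
  have hθn : ‖θ₀‖ ^ 2 = (p : ℝ)⁻¹ := by
    rw [← norm_pow, hθ₀, ← algebraMap_ratCast_padicComplex, hee]
    push_cast
    rw [norm_mul, norm_pow, norm_neg, norm_one, one_pow, one_mul, Padic.norm_p]
  have hθpos : 0 < ‖θ₀‖ := norm_pos_iff.mpr hθ₀0
  have hule : ‖θ₀‖ ≤ ‖algebraMap ℚ ℂ_[p] (C₂.u * D.u : ℚ)‖ := by
    have h := mul_le_mul_of_nonneg_right hu1 hθpos.le
    rwa [one_mul, mul_assoc, inv_mul_cancel₀ hθpos.ne', mul_one] at h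
  have hu0 : (C₂.u * D.u : ℚ) ≠ 0 := mul_ne_zero C₂.u.ne_zero D.u.ne_zero
  have hu0' : algebraMap ℚ ℂ_[p] (C₂.u * D.u : ℚ) ≠ 0 := by rw [map_ne_zero]; exact hu0
  have hnorm : ‖(((-1 : ℚ) ^ (p / 2) * p * (Dt'.c : ℚ) ^ 2 / (C₂.u * D.u : ℚ) ^ 2 : ℚ) : ℚ_[p])‖ ≤ 1 := by
    have hupos : 0 < ‖algebraMap ℚ ℂ_[p] (C₂.u * D.u : ℚ)‖ := norm_pos_iff.mpr hu0'
    rw [← hee, algebraMap_ratCast_padicComplex]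
    rw [map_div₀, map_mul, map_pow, map_pow, norm_div, norm_mul, norm_pow, norm_pow,
      div_le_one (pow_pos hupos 2)]
    have h1 : ‖algebraMap ℚ ℂ_[p] ((-1 : ℚ) ^ (p / 2) * p)‖ = (p : ℝ)⁻¹ := by rw [← hθ₀, norm_pow, hθn]
    have h2 : ‖algebraMap ℚ ℂ_[p] (Dt'.c : ℚ)‖ ≤ 1 := by
      rw [← algebraMap_ratCast_padicComplex, hee, Rat.cast_intCast]
      exact Padic.norm_int_le_one _
    calc ‖algebraMap ℚ ℂ_[p] ((-1 : ℚ) ^ (p / 2) * p)‖ * ‖algebraMap ℚ ℂ_[p] (Dt'.c : ℚ)‖ ^ 2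
        ≤ (p : ℝ)⁻¹ * 1 ^ 2 := by rw [h1]; gcongr
      _ = ‖θ₀‖ ^ 2 := by rw [one_pow, mul_one, hθn]
      _ ≤ ‖algebraMap ℚ ℂ_[p] (C₂.u * D.u : ℚ)‖ ^ 2 := by gcongr
  obtain ⟨r, hr⟩ := exists_unr_coe_eq_of_norm_le_one hnorm
  -- (3) the cofactor
  refine ⟨(U : unrIntegers p) * u_c * r, ?_⟩
  intro y hy θ hθ2 hθ s hs Q hQ
  have hv := hU _ (hval_c y hy θ hθ2 hθ s hs)
  -- (4) the descent of the logarithm along `ι′⁻¹|_{K[p]}`, which restricts to `embAt K p 𝔭′` on `K`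
  have hj : ∀ x : K, ((algebraMap (PadicAlgCl p) ℂ_[p]).comp
      (ι'.symm.toRingHom.comp (ringClassField K ιc p).subtype)) (algebraMap K (ringClassField K ιc p) x)
      = algebraMap ℚ_[p] ℂ_[p] (embAt K p 𝔮 h𝔮 he𝔮 hf𝔮 x) := by
    intro x
    rw [RingHom.comp_apply, RingHom.comp_apply, Subfield.coe_subtype, coe_algebraMap_ringClassField,
      RingEquiv.toRingHom_eq_coe, RingEquiv.coe_toRingHom,
      symm_apply_eq_embAt_of_forall_mem_iff_norm_lt_one h2 h𝔮₀ he₀ hf₀ h𝔮 he𝔮 hf𝔮 hne ι' ιc hind x,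
      ← IsScalarTower.algebraMap_apply]
  -- (the landed descent theorem carries the classical `DecidableEq K[p]`; `hQ` the subtype one —
  -- `Decidable` is data, `convert` bridges the two renderings by `Subsingleton.elim`)
  have hd := sq_padicLog_map_eq_of_descent p W' D C₂ ((-1 : ℚ) ^ (p / 2) * p) hθ2 hθ
    (∑ τ : ringClassGal ιc p, (s τ : ℤ) • pointGalHom W' (ringClassField K ιc p : Type) τ.1 y) Q
    (by convert hQ) (embAt K p 𝔮 h𝔮 he𝔮 hf𝔮) (algebraMap ℚ_[p] ℂ_[p]) hee _ hj hΔ'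
  -- replace `(log z)²` by the descended expression (the two renderings of `ℂ_p`'s instances agree
  -- definitionally; `convert` closes them)
  have hv' : L.HasValueAt 0 (((U : unrIntegers p) : ℂ_[p]) * (((u_c : unrIntegers p) : ℂ_[p]) *
      (algebraMap ℚ ℂ_[p] ((-1 : ℚ) ^ (p / 2) * p) * (algebraMap ℚ ℂ_[p] (C₂.u * D.u : ℚ))⁻¹ ^ 2 *
        (algebraMap ℚ_[p] ℂ_[p] (logOmega (C₂ • (D • W').quadraticTwist ((-1 : ℚ) ^ (p / 2) * p)) p
          (embAt K p 𝔮 h𝔮 he𝔮 hf𝔮) Q)) ^ 2))) := by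
    convert hv using 3
    exact hd.symm
  -- (5) bookkeeping
  have hcZ : Dt'.c ≠ 0 := Dt'.maninConstant_ne_zero_holds
  have hc0 : algebraMap ℚ_[p] ℂ_[p] (Dt'.c : ℚ_[p]) ≠ 0 := by
    rw [map_ne_zero]; exact_mod_cast hcZ
  have key := cofactor_identity (((U : unrIntegers p) : ℂ_[p])) ((u_c : unrIntegers p) : ℂ_[p])
    (algebraMap ℚ ℂ_[p] ((-1 : ℚ) ^ (p / 2) * p)) (algebraMap ℚ_[p] ℂ_[p] (Dt'.c : ℚ_[p]))
    (algebraMap ℚ ℂ_[p] (C₂.u * D.u : ℚ))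
    (algebraMap ℚ_[p] ℂ_[p] (logOmega (C₂ • (D • W').quadraticTwist ((-1 : ℚ) ^ (p / 2) * p)) p
      (embAt K p 𝔮 h𝔮 he𝔮 hf𝔮) Q)) hc0 hu0'
  rw [key] at hv'
  have hr' : ((r : unrIntegers p) : ℂ_[p]) = algebraMap ℚ ℂ_[p] ((-1 : ℚ) ^ (p / 2) * p) *
      (algebraMap ℚ_[p] ℂ_[p] (Dt'.c : ℚ_[p])) ^ 2 / (algebraMap ℚ ℂ_[p] (C₂.u * D.u : ℚ)) ^ 2 := by
    rw [hr, algebraMap_ratCast_padicComplex, map_div₀, map_mul, map_pow, map_pow,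
      ← algebraMap_ratCast_padicComplex (Dt'.c : ℚ), Rat.cast_intCast]
  rw [Subring.coe_mul, Subring.coe_mul, hr', map_div₀]
  exact hv'

end MainAt

end Summit.BirchSwinnertonDyer.BirchSwinnertonDyer.Theorems.SchneiderFree.KYRead.LogDescent

namespace Summit.BirchSwinnertonDyer.BirchSwinnertonDyer.Theorems.SchneiderFree

open PowerSeries Literature.NumberTheory.EllipticCurves.CaiShuTian2014
  Literature.NumberTheory.EllipticCurves.GreenbergSelmer Literature.NumberTheory.EllipticCurves.Rank1Residual
  Literature.NumberTheory.GaloisRepresentations Literature.NumberTheory.GaloisCohomology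
  Summit.BirchSwinnertonDyer.Rank1Residual.X11b.AcSelmer
  Summit.BirchSwinnertonDyer.BirchSwinnertonDyer.Theses.SchneiderFreeAdditiveX3
  Summit.BirchSwinnertonDyer.BirchSwinnertonDyer.Theorems.SchneiderFree.KYRead

/-- **The rebased road at one frame — branch currency, Gross-2004-free, with the VALUE HALF supplied by
Castella–Hsieh's value at their own frame, for an ARBITRARY complex embedding `ι_c`** (door-c3 gen 9's
`additiveIMCLowerBDPOnTreeLeAt_of_KY_branch_of_valueAt_conj_artin` with `hval` := gen 10's
`KYRead.LogDescent.hval_of_CH_frame_value`). New inputs w.r.t. gen 9: `hKYμ`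
(`thm351_mu_zero_branch_OPEN`, PREPRINT) and the CH frame
`(e_c = ±1, Ω_K^c ≠ 0, Ω_p^c ∈ R₀ˣ, L_c)` with its printed-shape value `hval_c` (cite item wi-73260);
REMOVED: `hval`. CONDITIONAL on the named facts, the preprint claims and the hypotheses; nothing
asserted about BSD. [cite: CastellaHsieh2018, Thm. 5.7 and Lemma 5.4 (arXiv:1505.08165 pp. 17–19) (shape of hval_c)]
[cite: KellerYin2024b, Thm. 3.5.1 (arXiv:2410.23241 p. 20) (preprint; (iii) and the μ-clause)] -/
theorem additiveIMCLowerBDPOnTreeLeAt_of_CH_frame_value_artin' (hmod : hasEntireLFunction_rat)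
    (hPar : nonempty_modularParametrizationData)
    (hRat : Literature.NumberTheory.EllipticCurves.phi_heegnerPointOfConductor_mem_ringClassField)
    (hCST : thm11_ringClassChar) (hKY : thm351_imc_isTorsion_mu_zero_charIdeal_eq_OPEN)
    (hKYb : thm351_charIdeal_eq_branch_OPEN) (hKYμ : thm351_mu_zero_branch_OPEN)
    (hCHx : castellaHsieh2018_exists_isBranchBDPLFunction)
    -- the prime, the good partner `W′`, the presentation of the door's curve
    {p : ℕ} [Fact p.Prime] (hp2 : p ≠ 2) (W' : WeierstrassCurve ℚ) [W'.IsElliptic]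
    [W'.IsGloballyMinimal] [NeZero (W'.conductorNorm ℤ)] (hgood : W'.HasGoodReductionAtPrime p)
    (hV' : padicValInt p W'.minimalDiscriminantInt < 6)
    (D : VariableChange ℚ) [(D • W').IsCharNeTwoNF] (C₂ : VariableChange ℚ)
    [(C₂ • (D • W').quadraticTwist ((-1 : ℚ) ^ (p / 2) * p)).IsElliptic]
    [(C₂ • (D • W').quadraticTwist ((-1 : ℚ) ^ (p / 2) * p)).IsGloballyMinimal]
    (hadd : Addv (C₂ • (D • W').quadraticTwist ((-1 : ℚ) ^ (p / 2) * p)) p)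
    -- the socket's field and frame
    {N : ℕ} [NeZero N] (K : Type) [Field K] [NumberField K] [IsGalois ℚ K]
    (hK : IsImaginaryQuadratic K)
    (hHe : SatisfiesHeegnerHypothesis N K) (hodd : Odd (NumberField.discr K))
    (hdK : NumberField.discr K ≠ -3) (hpw : ¬ p ∣ Units.torsionOrder K)
    {κ : ZpExtension K p} (hκ : κ.IsAnticyclotomic) {γ : Field.absoluteGaloisGroup K}
    [Fact (κ.IsTopGenerator γ)]
    {𝔭 : HeightOneSpectrum (𝓞 K)} (h𝔭 : ((p : ℕ) : 𝓞 K) ∈ 𝔭.asIdeal)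
    (he : 𝔭.asIdeal.ramificationIdx (𝓞 ℚ) = 1) (hf : 𝔭.asIdeal.inertiaDeg (𝓞 ℚ) = 1)
    -- the conjugate prime and an embedding datum inducing it
    {𝔭' : HeightOneSpectrum (𝓞 K)} (h𝔭' : ((p : ℕ) : 𝓞 K) ∈ 𝔭'.asIdeal)
    (he' : 𝔭'.asIdeal.ramificationIdx (𝓞 ℚ) = 1) (hf' : 𝔭'.asIdeal.inertiaDeg (𝓞 ℚ) = 1)
    (hne : 𝔭 ≠ 𝔭') {ι' : PadicAlgCl p ≃+* ℂ} (hι' : BranchInducesPrime p ι' 𝔭')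
    -- the route's Heegner datum and the printed facts for `E`
    (hGZ : gross_zagier N (C₂ • (D • W').quadraticTwist ((-1 : ℚ) ^ (p / 2) * p)) K)
    (hKo : kolyvagin N (C₂ • (D • W').quadraticTwist ((-1 : ℚ) ^ (p / 2) * p)) K)
    (Dt : ModularParametrizationData (C₂ • (D • W').quadraticTwist ((-1 : ℚ) ^ (p / 2) * p)) N)
    (H : HeegnerDatum N (NumberField.discr K)) (ιK : K →+* ℂ)
    (P : ((C₂ • (D • W').quadraticTwist ((-1 : ℚ) ^ (p / 2) * p)).baseChange K).toAffine.Point)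
    (hP : WeierstrassCurve.Affine.Point.map ιK.toRatAlgHom P = heegnerPointComplex Dt H)
    (hnt : ¬ IsOfFinAddOrder P)
    -- CTL₀ (control corner)
    {n : ℕ} (hn : XAc.HasCharValuationAt
      ((C₂ • (D • W').quadraticTwist ((-1 : ℚ) ^ (p / 2) * p)).baseChange K) p κ 𝔭 ∅ γ n)
    -- the good member of the isogeny class (Keller–Yin's per-curve hypotheses)
    {W₁ : WeierstrassCurve ℚ} [W₁.IsElliptic] [W₁.IsGloballyMinimal]
    (φ : WeierstrassCurve.Isogeny W₁ (C₂ • (D • W').quadraticTwist ((-1 : ℚ) ^ (p / 2) * p)))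
    {m d : ℕ} (hdeg : φ.degree = p ^ m * d) (hd : ¬ p ∣ d)
    (hN₁ : W₁.conductorNorm ℤ = N) (hcase₁ : W₁.HasGoodOrdinaryReductionOverQuadraticAt p)
    (hred₁ : Red W₁ p)
    (hlat₁ : ∃ Φ : AddSubgroup (geomTorsion W₁ (p : ℤ)),
      IsRationalLine W₁ p Φ ∧ ¬ LineDecompositionTrivialAt W₁ p Φ)
    (htf₁ : ∀ Q : (W₁.baseChange K).toAffine.Point, p • Q = 0 → Q = 0)
    -- the partner's parametrisation datum, the ring class field's embedding, the Manin side condition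
    (ιc : K →+* ℂ) [NumberField (ringClassField K ιc p)]
    (Dt' : ModularParametrizationData W' (W'.conductorNorm ℤ)) (hc0 : Dt.c ≠ 0)
    -- Castella–Hsieh's OWN frame at `𝔭′` and its printed-shape VALUE (cite item wi-73260)
    {e_c : ℂ} {ΩK_c : ℂ} {Ωp_c : (unrIntegers p)ˣ} {L_c : UnrSeries p} (he_c : e_c = 1 ∨ e_c = -1)
    (hΩK_c : ΩK_c ≠ 0)
    (hL_c : IsBranchBDPLFunction ι' 𝔭' κ γ Dt'.f (genusHeckeCharacter K p) e_c ΩK_c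
      ((Ωp_c : unrIntegers p) : ℂ_[p]) L_c)
    (u_c : unrIntegers p)
    (hval_c : ∀ (y : (W'.baseChange (ringClassField K ιc p : Type)).toAffine.Point),
      WeierstrassCurve.Affine.Point.map (ringClassField K ιc p).subtype.toRatAlgHom y =
        heegnerPointComplexOfConductor Dt' (NumberField.discr K) H.β p →
      ∀ (θ : ringClassField K ιc p)
        (_ : θ ^ 2 = algebraMap ℚ (ringClassField K ιc p) ((-1 : ℚ) ^ (p / 2) * p)) (_ : θ ≠ 0)
        (s : ringClassGal ιc p → ℤˣ),
        (∀ σ : ringClassGal ιc p, σ.1 θ = ((s σ : ℤ) : ringClassField K ιc p) * θ) →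
        L_c.HasValueAt 0 (((u_c : unrIntegers p) : ℂ_[p]) *
          (@padicLogPointFiniteExt ℂ_[p] _ NormedField.valuation (W'.baseChange ℂ_[p]) p
            (KYRead.LogDescent.isIntegral_valuation_baseChange W' ℂ_[p])
            (WeierstrassCurve.Affine.Point.map
              ((algebraMap (PadicAlgCl p) ℂ_[p]).comp
                (ι'.symm.toRingHom.comp (ringClassField K ιc p).subtype)).toRatAlgHom
              (∑ τ : ringClassGal ιc p,
                (s τ : ℤ) • pointGalHom W' (ringClassField K ιc p : Type) τ.1 y))) ^ 2)) :
    AdditiveIMCLowerBDPOnTreeLeAt p κ 𝔭 γ (embAt K p 𝔭 h𝔭 he hf) (padicValNat p Dt.c.natAbs) P := by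
  -- Keller–Yin's standing data for the good member at `(v, v̄) := (𝔭′, 𝔭)`, its newform, the twist relation
  have hpN' : ¬ p ∣ W'.conductorNorm ℤ := not_dvd_conductorNorm_of_hasGoodReductionAtPrime W' hgood
  have hS : PotOrdSetting ι' W₁ K 𝔭' 𝔭 κ N :=
    potOrdSetting_of_socketData hp2 ι' W₁ K 𝔭 𝔭' κ N hN₁ hcase₁ hred₁ hlat₁ htf₁ hK hHe hodd hdK hκ
      h𝔭 he hf hne hι'
  have hf₁ : IsNewformOf W₁ Dt.f := Dt.isNewformOf.of_isIsogenous ⟨φ⟩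
  have htw := exists_cofinite_cuspCoeff_eq_legendreSym_mul hp2 W' D C₂ Dt Dt'
  -- every `μ = 0` branch frame at `𝔭′` generates `Char_Λ(𝔛_{W₁})·R₀⟦T⟧` (KY (iii), branch currency)
  have hspan : ∀ (e : ℂ) (ΩK : ℂ) (Ωp : (unrIntegers p)ˣ) (L : UnrSeries p), e ≠ 0 → ΩK ≠ 0 →
      IsBranchBDPLFunction ι' 𝔭' κ γ Dt'.f (genusHeckeCharacter K p) e ΩK
        ((Ωp : unrIntegers p) : ℂ_[p]) L →
      ¬ C (p : unrIntegers p) ∣ L →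
      (AcSelmer.XAc.charIdeal (W₁.baseChange K) p κ 𝔭 ∅ γ).map (PowerSeries.map (toUnr p)) =
        Ideal.span {L} := by
    intro e ΩK Ωp L he0 hΩK hL hμ
    have hΩp : ((Ωp : unrIntegers p) : ℂ_[p]) ≠ 0 := by
      rw [Ne, ZeroMemClass.coe_eq_zero]; exact Ωp.ne_zero
    exact charIdeal_map_eq_span_of_branch_OPEN_of_not_dvd hKYb ι' W₁ K 𝔭' 𝔭 κ γ hf₁ hS
      Dt'.isNewformOf.1 hpN' htw he0 hΩK hΩp hL hμ (toUnr p) (coe_toUnr p)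
  -- `μ(L_c) = 0` (Keller–Yin's clause for Castella–Hsieh's normalisation)
  have hμ_c : ¬ C (p : unrIntegers p) ∣ L_c :=
    hKYμ ι' W₁ K 𝔭' 𝔭 κ γ hf₁ hS Dt'.isNewformOf.1 hpN' htw e_c ΩK_c Ωp_c L_c he_c hΩK_c hL_c
  have he_c0 : e_c ≠ 0 := by rcases he_c with rfl | rfl <;> norm_num
  -- the prime `𝔮 ∈ {𝔭, 𝔭′}` induced by `ι′⁻¹ ∘ ι_c`, and another degree-one prime `𝔮₀ ≠ 𝔮`
  have hsplit : X11b.SplitsIn K p := ncard_primesOver_eq_two_of_degreeOne hK.1 h𝔭 he hf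
  obtain ⟨he𝔮, hf𝔮⟩ := X11b.degreeOne_primeOfEmbeddingDatum p ι' hK.1 hsplit ιc
  have h𝔮 := X11b.natCast_mem_primeOfEmbeddingDatum p ι' ιc
  have hind : ∀ k : 𝓞 K, k ∈ (X11b.primeOfEmbeddingDatum p ι' ιc).asIdeal ↔ ‖ι'.symm (ιc (k : K))‖ < 1 :=
    fun k ↦ X11b.mem_primeOfEmbeddingDatum_iff p ι' ιc k
  have hrk : ((C₂ • (D • W').quadraticTwist ((-1 : ℚ) ^ (p / 2) * p)).baseChange K).mordellWeilRank
      = 1 := (hKo hK hHe ⟨Dt, H, ιK, hP⟩ hnt).1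
  -- the value half at every `μ = 0` frame, logarithm at `embAt K p 𝔮`, then moved to `𝔭′` (rank one)
  have hval𝔮 : ∀ (e : ℂ) (ΩK : ℂ) (Ωp : (unrIntegers p)ˣ) (L : UnrSeries p), e ≠ 0 → ΩK ≠ 0 →
      IsBranchBDPLFunction ι' 𝔭' κ γ Dt'.f (genusHeckeCharacter K p) e ΩK
        ((Ωp : unrIntegers p) : ℂ_[p]) L →
      ¬ C (p : unrIntegers p) ∣ L →
      ∃ u : unrIntegers p,
      ∀ (y : (W'.baseChange (ringClassField K ιc p : Type)).toAffine.Point),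
      WeierstrassCurve.Affine.Point.map (ringClassField K ιc p).subtype.toRatAlgHom y =
        heegnerPointComplexOfConductor Dt' (NumberField.discr K) H.β p →
      ∀ (θ : ringClassField K ιc p)
      (hθ2 : θ ^ 2 = algebraMap ℚ (ringClassField K ιc p) ((-1 : ℚ) ^ (p / 2) * p)) (hθ : θ ≠ 0)
      (s : ringClassGal ιc p → ℤˣ),
      (∀ σ : ringClassGal ιc p, σ.1 θ = ((s σ : ℤ) : ringClassField K ιc p) * θ) →
      ∀ Q : ((C₂ • (D • W').quadraticTwist ((-1 : ℚ) ^ (p / 2) * p)).baseChange K).toAffine.Point,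
      Affine.Point.map (algebraMap K (ringClassField K ιc p)).toRatAlgHom Q =
        VariableChange.pointEquivBaseChange ((D • W').quadraticTwist ((-1 : ℚ) ^ (p / 2) * p)) C₂
          (ringClassField K ιc p)
          ((VariableChange.pointEquiv (((D • W').quadraticTwist ((-1 : ℚ) ^ (p / 2) * p)).baseChange
              (ringClassField K ιc p : Type)) (untwistAt hθ)).symm
            ((Affine.Point.congrEquiv (untwistAt_smul_eq (D • W') hθ2 hθ)).symm
              (VariableChange.pointEquivBaseChange W' D (ringClassField K ιc p)
                (∑ τ : ringClassGal ιc p,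
                  (s τ : ℤ) • pointGalHom W' (ringClassField K ιc p : Type) τ.1 y)))) →
      L.HasValueAt 0 (((u : unrIntegers p) : ℂ_[p]) *
        (algebraMap ℚ_[p] ℂ_[p] (logOmega (C₂ • (D • W').quadraticTwist ((-1 : ℚ) ^ (p / 2) * p))
          p (embAt K p (X11b.primeOfEmbeddingDatum p ι' ιc) h𝔮 he𝔮 hf𝔮) Q / (Dt'.c : ℚ_[p]))) ^ 2) := by
    by_cases hq : X11b.primeOfEmbeddingDatum p ι' ιc = 𝔭'
    · exact KYRead.LogDescent.hval_of_CH_frame_value_at W' hgood D C₂ hK.1 H h𝔭 he hf h𝔮 he𝔮 hf𝔮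
        (fun h ↦ hne (h.trans hq)) ι' ιc hind Dt' _ hspan he_c0 hΩK_c hL_c hμ_c u_c hval_c
    · exact KYRead.LogDescent.hval_of_CH_frame_value_at W' hgood D C₂ hK.1 H h𝔭' he' hf' h𝔮 he𝔮 hf𝔮
        (fun h ↦ hq h.symm) ι' ιc hind Dt' _ hspan he_c0 hΩK_c hL_c hμ_c u_c hval_c
  have hval : ∀ (e : ℂ) (ΩK : ℂ) (Ωp : (unrIntegers p)ˣ) (L : UnrSeries p), e ≠ 0 → ΩK ≠ 0 →
      IsBranchBDPLFunction ι' 𝔭' κ γ Dt'.f (genusHeckeCharacter K p) e ΩK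
        ((Ωp : unrIntegers p) : ℂ_[p]) L →
      ¬ C (p : unrIntegers p) ∣ L →
      ∃ u : unrIntegers p,
      ∀ (y : (W'.baseChange (ringClassField K ιc p : Type)).toAffine.Point),
      WeierstrassCurve.Affine.Point.map (ringClassField K ιc p).subtype.toRatAlgHom y =
        heegnerPointComplexOfConductor Dt' (NumberField.discr K) H.β p →
      ∀ (θ : ringClassField K ιc p)
      (hθ2 : θ ^ 2 = algebraMap ℚ (ringClassField K ιc p) ((-1 : ℚ) ^ (p / 2) * p)) (hθ : θ ≠ 0)
      (s : ringClassGal ιc p → ℤˣ),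
      (∀ σ : ringClassGal ιc p, σ.1 θ = ((s σ : ℤ) : ringClassField K ιc p) * θ) →
      ∀ Q : ((C₂ • (D • W').quadraticTwist ((-1 : ℚ) ^ (p / 2) * p)).baseChange K).toAffine.Point,
      Affine.Point.map (algebraMap K (ringClassField K ιc p)).toRatAlgHom Q =
        VariableChange.pointEquivBaseChange ((D • W').quadraticTwist ((-1 : ℚ) ^ (p / 2) * p)) C₂
          (ringClassField K ιc p)
          ((VariableChange.pointEquiv (((D • W').quadraticTwist ((-1 : ℚ) ^ (p / 2) * p)).baseChange
              (ringClassField K ιc p : Type)) (untwistAt hθ)).symm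
            ((Affine.Point.congrEquiv (untwistAt_smul_eq (D • W') hθ2 hθ)).symm
              (VariableChange.pointEquivBaseChange W' D (ringClassField K ιc p)
                (∑ τ : ringClassGal ιc p,
                  (s τ : ℤ) • pointGalHom W' (ringClassField K ιc p : Type) τ.1 y)))) →
      L.HasValueAt 0 (((u : unrIntegers p) : ℂ_[p]) *
        (algebraMap ℚ_[p] ℂ_[p] (logOmega (C₂ • (D • W').quadraticTwist ((-1 : ℚ) ^ (p / 2) * p))
          p (embAt K p 𝔭' h𝔭' he' hf') Q / (Dt'.c : ℚ_[p]))) ^ 2) := by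
    intro e ΩK Ωp L he0 hΩK hL hμ
    obtain ⟨u, hu⟩ := hval𝔮 e ΩK Ωp L he0 hΩK hL hμ
    exact ⟨u, fun y hy θ hθ2 hθ s hs Q hQ ↦
      (SchneiderFreeAdditiveX3.hasValueAt_sq_logOmega_embAt_iff_of_rank_one
        (C₂ • (D • W').quadraticTwist ((-1 : ℚ) ^ (p / 2) * p)) p hK.1 hrk h𝔮 he𝔮 hf𝔮 h𝔭' he' hf' Q
        ((u : unrIntegers p) : ℂ_[p]) (Dt'.c : ℚ_[p]) L).mpr (hu y hy θ hθ2 hθ s hs Q hQ)⟩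
  exact additiveIMCLowerBDPOnTreeLeAt_of_KY_branch_of_valueAt_conj_artin hmod hPar hRat hCST hKY hKYb
    hCHx hp2 W' hgood hV' D C₂ hadd K hK hHe hodd hdK hpw hκ h𝔭 he hf h𝔭' he' hf' hne hι' hGZ hKo Dt H
    ιK P hP hnt hn φ hdeg hd hN₁ hcase₁ hred₁ hlat₁ htf₁ ιc Dt' hc0 hval


end Summit.BirchSwinnertonDyer.BirchSwinnertonDyer.Theorems.SchneiderFree

end
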